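import Literature.AlgebraicGeometry.Motives.ProjectiveSpaceLinearMaps
import Literature.NumberTheory.Transcendental.AnalytificationProjProofs
import HarnessLib

/-!
# Linear maps `ℙʳ_k → ℙᴺ_k` on field-valued and complex points: `[y] ↦ [τ₀(y) : ⋯ : τ_N(y)]`

Family `hodge`, layer `Literature/AlgebraicGeometry/Motives`. PROOF FILE (theorems only) completing
`Motives/ProjectiveSpaceLinearMaps` (`ProjectiveSpace.linSubstMap τ : ℙʳ_k ⟶ ℙᴺ_k`, the linear map
`= Proj σ_τ` of a substitution `xᵢ ↦ τᵢ(y)` by linear forms hitting every variable) with its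
ACTION ON POINTS, exactly as the coordinate embedding `ProjectiveSpace.skipMap`
(`Motives/ProjectiveSpaceCoordinateEmbedding`, `pointOfVec_comp_skipMap`, same proof skeleton):

* `aeval_linSubstGraded_eq` — `(σ_τ g)(y) = g(τ(y))` (Mathlib `comp_aeval`);
* `linSubstVec_ne_zero` — `τ(y) ≠ 0` for `y ≠ 0` (every `y_j` is a `τᵢ`);
* `awayEval_comp_awayMap_linSubstGraded` — on the charts, evaluation at `y` after the comorphism
  `Away.map σ_τ xᵢ` is evaluation at `τ(y)`;
* `pointOfVec_comp_linSubstMap` — **`[y] ↦ [τ(y)]` on `L`-points** (Hartshorne II Ex. 2.14: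
  morphisms of `Proj` induced by graded maps, read on points; II Example 7.1.1);
* `projPoint_mk_eq_pointOfVec` — Serre's comparison point `projPoint N [v] ∈ ℙᴺ_ℂ(ℂ)` of
  `NumberTheory/Transcendental/AnalytificationProjProofs` IS the `ℂ`-point `pointOfVec ℂ v` of
  `Motives/ProjectiveSpaceFieldPoints` (both are characterised by the basic opens containing them);
* `map_linSubstMap_projPoint_mk` — **on complex points, `linSubstMap τ` is `[y] ↦ [τ(y)]`** in the
  homogeneous coordinates of `ℙ ℂ (Fin _ → ℂ)`.

Everything is proved; no definitions, no named facts.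

## References

* R. Hartshorne, *Algebraic Geometry*, GTM 52 (1977): II Ex. 2.14, II Example 7.1.1. [Hartshorne1977]
* J.-P. Serre, GAGA, Ann. Inst. Fourier 6 (1956), §2 n°5. [SerreGAGA1956]
-/

noncomputable section

open CategoryTheory AlgebraicGeometry HomogeneousLocalization MvPolynomial
open scoped LinearAlgebra.Projectivization

universe u

namespace Literature.AlgebraicGeometry.Motives

namespace ProjectiveSpace

variable {k : Type u} [Field k] {N r : ℕ}

attribute [local instance] MvPolynomial.gradedAlgebra ProjBaseChange.algebraBase

/-- The grading of the source ring `k[x₀, …, x_N]` by degree (`ℙᴺ = Proj 𝓐`). -/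
local notation "𝓐" => MvPolynomial.homogeneousSubmodule (Fin (N + 1)) k
/-- The grading of the target ring `k[y₀, …, y_r]` by degree (`ℙʳ = Proj 𝓑`). -/
local notation "𝓑" => MvPolynomial.homogeneousSubmodule (Fin (r + 1)) k

variable (τ : Fin (N + 1) → MvPolynomial (Fin (r + 1)) k) (hτ : ∀ i, (τ i).IsHomogeneous 1)
  (hgen : ∀ j : Fin (r + 1), ∃ i, τ i = X j)

/-! ### The action on field-valued points -/

section Points

variable {L : Type u} [Field L] [Algebra k L]

/-- `(σ_τ g)(y) = g(τ₀(y), …, τ_N(y))`: evaluating the substituted polynomial (Mathlib `comp_aeval`).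
[folklore] -/
theorem aeval_linSubstGraded_eq (y : Fin (r + 1) → L) (g : MvPolynomial (Fin (N + 1)) k) :
    aeval y (linSubstGraded τ hτ g) = aeval (fun i ↦ aeval y (τ i)) g := by
  rw [linSubstGraded_apply, ← AlgHom.comp_apply, MvPolynomial.comp_aeval]

include hgen in
/-- `τ(y) ≠ 0` for `y ≠ 0`: some `τᵢ` is the variable `y_j` with `y_j ≠ 0`. [folklore] -/
theorem linSubstVec_ne_zero {y : Fin (r + 1) → L} (hy : y ≠ 0) : (fun i ↦ aeval y (τ i)) ≠ 0 := by
  obtain ⟨j, hj⟩ := Function.ne_iff.mp hy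
  obtain ⟨i, hi⟩ := hgen j
  exact Function.ne_iff.mpr ⟨i, by rwa [hi, aeval_X]⟩

/-- **Evaluation at `y` after `Away.map σ_τ xᵢ` is evaluation at `τ(y)`**: the comorphism of the
linear map on the charts `D₊(τᵢ) → D₊(xᵢ)`, composed with an `L`-point. [folklore] -/
theorem awayEval_comp_awayMap_linSubstGraded (y : Fin (r + 1) → L) (i : Fin (N + 1))
    (hy : aeval y (linSubstGraded τ hτ (X i : MvPolynomial (Fin (N + 1)) k)) ≠ 0)
    (hy' : aeval (fun i ↦ aeval y (τ i)) (X i : MvPolynomial (Fin (N + 1)) k) ≠ 0) :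
    (awayEval y hy).toRingHom.comp (Away.map (linSubstGraded τ hτ) (X i : MvPolynomial (Fin (N + 1)) k)) =
      (awayEval (fun i ↦ aeval y (τ i)) hy').toRingHom := by
  ext q
  obtain ⟨m, g, hg, rfl⟩ := q.mk_surjective _ (X_mem i)
  rw [RingHom.comp_apply, Away.map_mk]
  change awayEval y hy _ = awayEval (fun i ↦ aeval y (τ i)) hy' _
  rw [awayEval_mk, awayEval_mk, aeval_linSubstGraded_eq, aeval_linSubstGraded_eq]

/-- **The linear map on points: `[y₀ : ⋯ : y_r] ↦ [τ₀(y) : ⋯ : τ_N(y)]`** (Hartshorne II Ex. 2.14: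
the morphism of `Proj` induced by a graded homomorphism, read on `L`-points through the charts
`D₊(τᵢ) → D₊(xᵢ)`, Mathlib `Proj.awayι_comp_map`). [cite: Hartshorne1977, II Ex. 2.14] -/
theorem pointOfVec_comp_linSubstMap (y : Fin (r + 1) → L) (hy : y ≠ 0) :
    pointOfVec k y hy ≫ linSubstMap τ hτ hgen =
      pointOfVec k (fun i ↦ aeval y (τ i)) (linSubstVec_ne_zero τ hgen hy) := by
  obtain ⟨j, hj⟩ := Function.ne_iff.mp hy
  obtain ⟨i, hi⟩ := hgen j
  have hi' : aeval (fun i ↦ aeval y (τ i)) (X i : MvPolynomial (Fin (N + 1)) k) ≠ 0 :=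
    aeval_X_ne_zero (by rwa [hi, aeval_X])
  have hyi : aeval y (linSubstGraded τ hτ (X i : MvPolynomial (Fin (N + 1)) k)) ≠ 0 := by
    rwa [aeval_linSubstGraded_eq]
  rw [pointOfVec_eq_chartPoint y hy ((linSubstGraded τ hτ).map_mem (X_mem i)) one_pos hyi,
    pointOfVec_eq_chartPoint _ (linSubstVec_ne_zero τ hgen hy) (X_mem i) one_pos hi']
  ext : 1
  rw [Over.comp_left, chartPoint_left, chartPoint_left, linSubstMap_left, linSubstMapHom_eq]
  change (Spec.map (CommRingCat.ofHom (awayEval y hyi).toRingHom) ≫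
      Proj.awayι 𝓑 (linSubstGraded τ hτ (X i)) ((linSubstGraded τ hτ).map_mem (X_mem i)) one_pos) ≫
        Proj.map (linSubstGraded τ hτ) (irrelevant_le_map_linSubstGraded τ hτ hgen) =
    Spec.map (CommRingCat.ofHom (awayEval (fun i ↦ aeval y (τ i)) hi').toRingHom) ≫
      Proj.awayι 𝓐 (X i) (X_mem i) one_pos
  rw [Category.assoc, Proj.awayι_comp_map _ _ one_pos (X i) (X_mem i), ← Category.assoc,
    ← Spec.map_comp, ← CommRingCat.ofHom_comp,
    awayEval_comp_awayMap_linSubstGraded τ hτ y i hyi hi']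

end Points

end ProjectiveSpace

/-! ### Complex points: `linSubstMap` in the homogeneous coordinates of `ℙ ℂ (Fin _ → ℂ)` -/

section Complex

open Literature.NumberTheory.Transcendental

attribute [local instance] MvPolynomial.gradedAlgebra ProjBaseChange.algebraBase

/-- **The two dictionaries of homogeneous coordinates agree**: Serre's comparison point
`projPoint N [v] ∈ ℙᴺ_ℂ(ℂ)` (`NumberTheory/Transcendental/AnalytificationProjProofs`) is the
`ℂ`-point `ProjectiveSpace.pointOfVec ℂ v` of `Motives/ProjectiveSpaceFieldPoints` — both lie in the
same basic opens `D₊(f)` (`pt_pointOfVec_mem_basicOpen_iff` on either side), and a point of `Proj`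
is determined by those (`Proj.ext_of_forall_mem_basicOpen_iff`), a complex point by its underlying
point (`ComplexPoints.ext_of_pt_eq`). [cite: SerreGAGA1956, §2 n°5] -/
theorem projPoint_mk_eq_pointOfVec (N : ℕ) (v : Fin (N + 1) → ℂ) (hv : v ≠ 0) :
    projPoint N (Projectivization.mk ℂ v hv) = ProjectiveSpace.pointOfVec ℂ v hv := by
  refine ComplexPoints.ext_of_pt_eq ?_
  rw [projPoint_mk]
  refine Literature.NumberTheory.Transcendental.Proj.ext_of_forall_mem_basicOpen_iff
    (MvPolynomial.homogeneousSubmodule (Fin (N + 1)) ℂ) fun m hm f hf ↦ ?_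
  exact (Literature.NumberTheory.Transcendental.pt_pointOfVec_mem_basicOpen_iff N v hv hm hf).trans
    (Iff.trans Iff.rfl (ProjectiveSpace.pt_pointOfVec_mem_basicOpen_iff v hv hm hf).symm)

variable {N r : ℕ} (τ : Fin (N + 1) → MvPolynomial (Fin (r + 1)) ℂ) (hτ : ∀ i, (τ i).IsHomogeneous 1)
  (hgen : ∀ j : Fin (r + 1), ∃ i, τ i = X j)

/-- **On complex points the linear map is `[y] ↦ [τ(y)]`**: for `y ≠ 0` in `ℂʳ⁺¹`,
`(linSubstMap τ)(ℂ)` sends the point `[y]` of `ℙʳ_ℂ(ℂ)` to the point `[τ₀(y) : ⋯ : τ_N(y)]` of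
`ℙᴺ_ℂ(ℂ)`, in the coordinates `projPoint` of the tree's analytification of projective space.
[cite: Hartshorne1977, II Ex. 2.14] [cite: SerreGAGA1956, §2 n°5] -/
theorem map_linSubstMap_projPoint_mk (y : Fin (r + 1) → ℂ) (hy : y ≠ 0) :
    AlgPoints.map (ProjectiveSpace.linSubstMap τ hτ hgen) (projPoint r (Projectivization.mk ℂ y hy)) =
      projPoint N (Projectivization.mk ℂ (fun i ↦ aeval y (τ i))
        (ProjectiveSpace.linSubstVec_ne_zero τ hgen hy)) := by
  rw [projPoint_mk_eq_pointOfVec, projPoint_mk_eq_pointOfVec, AlgPoints.map_apply,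
    ProjectiveSpace.pointOfVec_comp_linSubstMap]

end Complex

end Literature.AlgebraicGeometry.Motives

end
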